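import Summits.BirchSwinnertonDyer.BirchSwinnertonDyer.Theorems.ByReductionTypeAtTwoAdditiveReducibleKatoMember
import Literature.NumberTheory.EllipticCurves.IsogenyFrobeniusTraceProofs
import Literature.NumberTheory.EllipticCurves.BSDSelmerCMPConverseMaximalOrderProofs
import Literature.NumberTheory.EllipticCurves.ComplexMultiplicationBSDTripleProofs
import Literature.NumberTheory.EllipticCurves.LutzNagellGeneralWeierstrass
import Literature.NumberTheory.EllipticCurves.SerreOpenImageOrdinaryInertiaProofs
import Literature.NumberTheory.EllipticCurves.BSDInvariantsProofs
import Literature.NumberTheory.EllipticCurves.GlobalMinimalModelProofs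
import HarnessLib

/-!
# K4 crux `AdditiveRankZeroAtTwo` (item 19098): a KERNEL certificate for the isogeny-class torsion
# side condition of Kato's member door at `2` (C2″ of the v2.2 split)

Cell `bsd-2adic`, seat `bsd-2adic-addL2x` GEN 12. HONEST FRAMING: types-the-object-of; closes nothing at
the ∀-level; BSD is not proved by any of this. Theorems only (no `def`, no named fact, no instance).

GEN 10's member door `AddKatoTwo.missingUpperBoundAt_two_of_katoMember_two` (p624850; Kato 2004
Thm. 12.4–12.6 / §13–14 READ AT `p = 2` at Kato's MEMBER of the isogeny class, named transcription
`Kato2004.exists_memberHullInputs_two` p624448, D-audit hMH2@2 PASS) turns the member bound into the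
UPPER half `MissingUpperBoundAt W 2` under two side conditions, the first of which quantifies over the
WHOLE `ℚ`-isogeny class of `W`:

  `hsmall : ∀ W' elliptic, IsIsogenous W W' → ¬ 2² ∣ #W'(ℚ)_tors`

(GEN 10/11: «evidence-level only — no kernel enumeration of an isogeny class», R-B56; the planner's
child C2″ `AdditivePotGoodReducibleRestAtTwo` carries it verbatim). This file DISCHARGES `hsmall` in
kernel from ONE good odd prime of `W` ALONE:

* `forall_isIsogenous_not_four_dvd_torsionOrder_of_reductionPointCount` — if `ℓ` is an odd prime of
  good reduction of the globally minimal `W` with `4 ∤ #W̃(𝔽_ℓ)` (`reductionPointCount W ℓ`), then NO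
  curve `ℚ`-isogenous to `W` has rational torsion of order divisible by `4`. Proof, all in the tree:
  a global minimal model `C • W'` of the isogenous curve (Néron, `hasGlobalMinimalModel_rat_holds`),
  `IsIsogenous.smul_right`, good reduction is an isogeny invariant (`IsIsogenous.hasGoodReductionAtPrime_iff`,
  Silverman VII.7.2), **`a_ℓ` is an isogeny invariant at a common good prime**
  (`frobeniusTrace_eq_of_isIsogenous`, Faltings' Korollar 2 (i) ⇒ (iv), proved in the tree via Tate
  modules), hence `#W̃'(𝔽_ℓ) = #W̃(𝔽_ℓ)`, and `#W'(ℚ)_tors ∣ #W̃'(𝔽_ℓ)` (Knapp Thm. 5.1 (c),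
  `torsionOrder_dvd_reductionPointCount`), with `torsionOrder_variableChange_holds`.
* `missingUpperBoundAt_two_of_katoMember_two_of_torsionCertificate` — GEN 10's door with `hsmall`
  replaced by the certificate `(ℓ, good, odd, 4 ∤ #W̃(𝔽_ℓ))`: the reducible DOOR rows of the census
  (201 defect-≥3 classes, kit j306106; 6 C₂ classes, kit j307312) become KERNEL-rung-able (the second
  side condition, `ord₂ Ш_an` even, stays a per-class input as in every rung of the cell).

By Katz 1981 (Galois properties of torsion points, Thm. 2 — print, not used here) a certifying prime
`ℓ` EXISTS iff no isogenous curve has `4 ∣ #tors`, so the certificate loses nothing: the side condition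
of C2″ is equivalent to «∃ odd good ℓ, 4 ∤ #W̃(𝔽_ℓ)», a condition on `W` alone.
-/

noncomputable section

set_option autoImplicit false
set_option linter.dupNamespace false

open scoped Classical

namespace Summit.BirchSwinnertonDyer.BirchSwinnertonDyer.Theorems.AddKatoTwo

open WeierstrassCurve Literature.NumberTheory.EllipticCurves
  Literature.NumberTheory.EllipticCurves.ModularForms
  Literature.NumberTheory.EllipticCurves.Kato2004
  Literature.NumberTheory.EllipticCurves.LutzNagellGeneral
  Literature.NumberTheory.IwasawaTheory
  Literature.NumberTheory.EllipticCurves.Rank1Residual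
  Literature.NumberTheory.EllipticCurves.Rank1Residual.Typed

/-! ## §1 The torsion certificate: one good odd prime controls the 2-power torsion of the whole isogeny class -/

/-- **`4 ∤ #W̃(𝔽_ℓ)` at ONE odd good prime `ℓ` ⟹ no `ℚ`-isogenous curve has `4 ∣ #tors`.** For a
globally minimal elliptic `W/ℚ`, an odd prime `ℓ` of good reduction with `4 ∤ #W̃(𝔽_ℓ)`
(`reductionPointCount W ℓ = ℓ + 1 − a_ℓ`), and ANY elliptic `W'` (any model) `ℚ`-isogenous to `W`:
`¬ 2² ∣ #W'(ℚ)_tors`. Isogeny invariance of `a_ℓ` (Faltings Kor. 2 (i)⇒(iv), tree theorem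
`frobeniusTrace_eq_of_isIsogenous`) and of good reduction (Silverman VII.7.2), a global minimal model
of `W'` (Silverman VIII.8.3), and `#E(ℚ)_tors ∣ #Ẽ(𝔽_ℓ)` for odd good `ℓ` (Knapp Thm. 5.1 (c)).
[cite: SilvermanAEC2009, VII.7.2, VIII.8.3 and VII.3.1(b)] [cite: Knapp1993, Ch. V §1 Thm. 5.1(c)] -/
theorem forall_isIsogenous_not_four_dvd_torsionOrder_of_reductionPointCount
    (W : WeierstrassCurve ℚ) [W.IsElliptic] [W.IsGloballyMinimal] (ℓ : ℕ) [Fact ℓ.Prime] (hℓ : ℓ ≠ 2)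
    (hgood : W.HasGoodReductionAtPrime ℓ) (h4 : ¬ 4 ∣ W.reductionPointCount ℓ) :
    ∀ (W' : WeierstrassCurve ℚ) [W'.IsElliptic], IsIsogenous W W' → ¬ 2 ^ 2 ∣ W'.torsionOrder := by
  intro W' _ hiso h4'
  -- a global minimal model `M = C • W'` of the isogenous curve
  obtain ⟨C, hC⟩ := hasGlobalMinimalModel_rat_holds W'
  haveI := hC
  have hisoM : IsIsogenous W (C • W') := hiso.smul_right C
  have htors : (C • W').torsionOrder = W'.torsionOrder := torsionOrder_variableChange_holds W' C
  have hgoodM : (C • W').HasGoodReductionAtPrime ℓ := (hisoM.hasGoodReductionAtPrime_iff ℓ).mp hgood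
  -- `a_ℓ(W) = a_ℓ(M)`, hence equal point counts
  have hap : W.frobeniusTrace ℓ = (C • W').frobeniusTrace ℓ :=
    frobeniusTrace_eq_of_isIsogenous hisoM ℓ hgood hgoodM
  have hN : (C • W').reductionPointCount ℓ = W.reductionPointCount ℓ := by
    have h : ((C • W').reductionPointCount ℓ : ℤ) = (W.reductionPointCount ℓ : ℤ) := by
      have h1 : ((C • W').reductionPointCount ℓ : ℤ) = (ℓ : ℤ) + 1 - (C • W').frobeniusTrace ℓ := by
        unfold frobeniusTrace; ring
      have h2 : (W.reductionPointCount ℓ : ℤ) = (ℓ : ℤ) + 1 - W.frobeniusTrace ℓ := by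
        unfold frobeniusTrace; ring
      rw [h1, h2, hap]
    exact_mod_cast h
  -- `#M(ℚ)_tors ∣ #M̃(𝔽_ℓ)`
  have hdvd : (C • W').torsionOrder ∣ (C • W').reductionPointCount ℓ :=
    torsionOrder_dvd_reductionPointCount (C • W') ℓ (Or.inl hℓ)
      (not_dvd_minimalDiscriminantInt_of_hasGoodReductionAtPrime' (C • W') ℓ hgoodM)
  rw [htors, hN] at hdvd
  have h4'' : 4 ∣ W'.torsionOrder := by simpa using h4'
  exact h4 (h4''.trans hdvd)

/-- The certificate in `#tors`-currency without the square: `4 ∤ #W̃(𝔽_ℓ)` at an odd good `ℓ` ⟹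
`4 ∤ #W'(ℚ)_tors` for every `W'` `ℚ`-isogenous to `W`. [cite: SilvermanAEC2009, VII.7.2 and VIII.8.3] [cite: Knapp1993, Ch. V §1 Thm. 5.1(c)] -/
theorem forall_isIsogenous_not_four_dvd_torsionOrder_of_reductionPointCount'
    (W : WeierstrassCurve ℚ) [W.IsElliptic] [W.IsGloballyMinimal] (ℓ : ℕ) [Fact ℓ.Prime] (hℓ : ℓ ≠ 2)
    (hgood : W.HasGoodReductionAtPrime ℓ) (h4 : ¬ 4 ∣ W.reductionPointCount ℓ)
    (W' : WeierstrassCurve ℚ) [W'.IsElliptic] (hiso : IsIsogenous W W') : ¬ 4 ∣ W'.torsionOrder := by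
  have h := forall_isIsogenous_not_four_dvd_torsionOrder_of_reductionPointCount W ℓ hℓ hgood h4 W' hiso
  simpa using h

/-! ## §2 GEN 10's member door at `2` with the certificate in place of the isogeny-class side condition -/

/-- **Kato's member door at `2`, certificate form.** GEN 10's `missingUpperBoundAt_two_of_katoMember_two`
(PRINT {modularity, Lim 2017 Thm 3.5@2, Ferrero–Washington, Cassels, Cassels–Tate, GZK} + READING
`Kato2004.exists_memberHullInputs_two` ⟹ the UPPER half at `2` for a non-CM globally minimal `W`,
additive and potentially good at `2`, `W[2]` reducible, analytic rank `0`) with its isogeny-class side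
condition `hsmall` DISCHARGED by §1 from ONE odd good prime `ℓ` with `4 ∤ #W̃(𝔽_ℓ)`; the parity side
condition `heven` (ord₂ Ш_an even) is kept. [cite: Kato2004, Thm. 12.5, §13.13–13.14, Thm. 14.5, Prop. 14.16 (2)]
[cite: SilvermanAEC2009, VII.7.2] [cite: Knapp1993, Ch. V §1 Thm. 5.1(c)] -/
theorem missingUpperBoundAt_two_of_katoMember_two_of_torsionCertificate (hmod : exists_isNewformOf)
    (hin : Kato2004.exists_memberHullInputs_two)
    (hLim2 : Lim2017.thm35_at_two_fineSelmerDual_moduleFinite_of_classicalMuVanishes_of_le_divisionField_four)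
    (hFW : ferreroWashington1979_classicalMuVanishes)
    (hCassels : bsdRHS_eq_of_isIsogenous) (hCT : exists_casselsTate_pairing (K := ℚ))
    (hGZK : rank_eq_analyticRank_of_analyticRank_le_one) (hrat : hasEntireLFunction_rat)
    (W : WeierstrassCurve ℚ) [W.IsElliptic] [W.IsGloballyMinimal] (hcm : ¬ W.HasCM)
    (hng : ¬ W.HasGoodReductionAtPrime 2) (hnm : ¬ W.HasMultiplicativeReductionAtPrime 2)
    (hj : 0 ≤ padicValRat 2 W.j) (hred : ¬ W.HasIrreducibleModPGaloisRep 2)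
    (hr : W.analyticRank = 0)
    (ℓ : ℕ) [Fact ℓ.Prime] (hℓ : ℓ ≠ 2) (hgood : W.HasGoodReductionAtPrime ℓ)
    (h4 : ¬ 4 ∣ W.reductionPointCount ℓ)
    (heven : ∀ q : ℚ, shaAn W = (q : ℂ) → Even (padicValRat 2 q)) :
    MissingUpperBoundAt W 2 :=
  missingUpperBoundAt_two_of_katoMember_two hmod hin hLim2 hFW hCassels hCT hGZK hrat W hcm hng hnm hj
    hred hr (forall_isIsogenous_not_four_dvd_torsionOrder_of_reductionPointCount W ℓ hℓ hgood h4) heven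

/-! ## §3 The certificate for an arbitrary modulus (any prime `p`, any cell): one good odd prime controls
`m`-divisibility of the rational torsion over the whole `ℚ`-isogeny class -/

/-- **`m ∤ #W̃(𝔽_ℓ)` at ONE odd good prime `ℓ` ⟹ no `ℚ`-isogenous curve has `m ∣ #tors`**, for EVERY
natural number `m` (the case `m = 4` is §1; `m = p` odd serves the member doors at odd `p`): for a
globally minimal elliptic `W/ℚ`, an odd prime `ℓ` of good reduction with `m ∤ #W̃(𝔽_ℓ)`, and ANY elliptic
`W'` (any model) `ℚ`-isogenous to `W`: `m ∤ #W'(ℚ)_tors`. Same proof: a global minimal model of `W'`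
(Silverman VIII.8.3), isogeny invariance of good reduction (VII.7.2) and of `a_ℓ`
(`frobeniusTrace_eq_of_isIsogenous`), and `#E(ℚ)_tors ∣ #Ẽ(𝔽_ℓ)` (Knapp Thm. 5.1 (c)).
[cite: SilvermanAEC2009, VII.7.2, VIII.8.3 and VII.3.1(b)] [cite: Knapp1993, Ch. V §1 Thm. 5.1(c)] -/
theorem forall_isIsogenous_not_dvd_torsionOrder_of_not_dvd_reductionPointCount
    (W : WeierstrassCurve ℚ) [W.IsElliptic] [W.IsGloballyMinimal] (ℓ : ℕ) [Fact ℓ.Prime] (hℓ : ℓ ≠ 2)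
    (hgood : W.HasGoodReductionAtPrime ℓ) (m : ℕ) (hm : ¬ m ∣ W.reductionPointCount ℓ)
    (W' : WeierstrassCurve ℚ) [W'.IsElliptic] (hiso : IsIsogenous W W') : ¬ m ∣ W'.torsionOrder := by
  intro hm'
  obtain ⟨C, hC⟩ := hasGlobalMinimalModel_rat_holds W'
  haveI := hC
  have hisoM : IsIsogenous W (C • W') := hiso.smul_right C
  have htors : (C • W').torsionOrder = W'.torsionOrder := torsionOrder_variableChange_holds W' C
  have hgoodM : (C • W').HasGoodReductionAtPrime ℓ := (hisoM.hasGoodReductionAtPrime_iff ℓ).mp hgood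
  have hap : W.frobeniusTrace ℓ = (C • W').frobeniusTrace ℓ :=
    frobeniusTrace_eq_of_isIsogenous hisoM ℓ hgood hgoodM
  have hN : (C • W').reductionPointCount ℓ = W.reductionPointCount ℓ := by
    have h : ((C • W').reductionPointCount ℓ : ℤ) = (W.reductionPointCount ℓ : ℤ) := by
      have h1 : ((C • W').reductionPointCount ℓ : ℤ) = (ℓ : ℤ) + 1 - (C • W').frobeniusTrace ℓ := by
        unfold frobeniusTrace; ring
      have h2 : (W.reductionPointCount ℓ : ℤ) = (ℓ : ℤ) + 1 - W.frobeniusTrace ℓ := by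
        unfold frobeniusTrace; ring
      rw [h1, h2, hap]
    exact_mod_cast h
  have hdvd : (C • W').torsionOrder ∣ (C • W').reductionPointCount ℓ :=
    torsionOrder_dvd_reductionPointCount (C • W') ℓ (Or.inl hℓ)
      (not_dvd_minimalDiscriminantInt_of_hasGoodReductionAtPrime' (C • W') ℓ hgoodM)
  rw [htors, hN] at hdvd
  exact hm (hm'.trans hdvd)

/-- **The point count is an isogeny-class invariant at a good odd prime, in `#tors`-currency**:
`#W'(ℚ)_tors ∣ #W̃(𝔽_ℓ)` for EVERY `W'` `ℚ`-isogenous to the globally minimal `W`, `ℓ` an odd prime of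
good reduction of `W` (so a single point count of `W` bounds the torsion of its whole isogeny class).
[cite: SilvermanAEC2009, VII.7.2 and VIII.8.3] [cite: Knapp1993, Ch. V §1 Thm. 5.1(c)] -/
theorem torsionOrder_dvd_reductionPointCount_of_isIsogenous
    (W : WeierstrassCurve ℚ) [W.IsElliptic] [W.IsGloballyMinimal] (ℓ : ℕ) [Fact ℓ.Prime] (hℓ : ℓ ≠ 2)
    (hgood : W.HasGoodReductionAtPrime ℓ) (W' : WeierstrassCurve ℚ) [W'.IsElliptic]
    (hiso : IsIsogenous W W') : W'.torsionOrder ∣ W.reductionPointCount ℓ := by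
  by_contra h
  exact forall_isIsogenous_not_dvd_torsionOrder_of_not_dvd_reductionPointCount W ℓ hℓ hgood
    W'.torsionOrder h W' hiso dvd_rfl

end Summit.BirchSwinnertonDyer.BirchSwinnertonDyer.Theorems.AddKatoTwo
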